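import Summits.QuantumFields.YangMills.Theorems.UnitScaleTiltProp7SectET3NormG
import Summits.QuantumFields.YangMills.Theorems.UnitScaleTiltProp7SectET3Letters
import Literature.MathematicalPhysics.QuantumFieldTheory.Balaban1983to89.B9Thm313WholeLeafRelZ
import Literature.MathematicalPhysics.QuantumFieldTheory.Balaban1983to89.B9CoRealizesRelAtLetters
import Literature.MathematicalPhysics.QuantumFieldTheory.Balaban1983to89.B9CarrierBlockMultiplicity
import HarnessLib

/-!
# Route `UnitScaleTilt`, crux «MinimiserStabilityRegPr» (stmt-QuantumFields-19200, v10 stub EX, route (α), node N06(d = 3)) — (N06-3-4), THE T³ LEAF IN THE REPAIRED LETTER SPECIES: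
# **`B9.Thm313Printed` AT THE T³ INDEX WITH THE Z-CLASSED (3.132)∕(3.126) LETTERS `LettersRowZT3` AND CARRIER-RELATIVE CO-READINGS** — Track A's `B9Thm313WholeLeafRelZ.thm313Printed_of_stepRelZ`
# (R1-cls twin of the `_coGlob` leaf) read at d + 1 = 3, with the relation `RelB` («same carrier block») and its saturation ∕ multiplicity rows DISCHARGED

Cell `ym3-torus` (HUMAN RULING D-0037, YM ladder rung R3 — NOT the Clay problem), width seat ym-ust-20520-w1 g3.  Count-neutral helper (`--supports stmt-QuantumFields-19200 --as
helper`); registry untouched; THEOREMS ONLY (0 `def`, 0 `sorry`); NOTHING of [Balaban1985BackgroundPropagators] is asserted.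

WHY (the flat-U census `Prop7SectET3LettersAtOne`, this seat).  The chain ✓ p601287 ∕ ✓ p602933 displays the PLAIN letter species `hletters : LettersRowT3 …` (= `Letters313`), whose `C₁`-letters
`c1_2 ∕ c1_1` read `(QG₁Q*)⁻¹` between FLAT coarse classes — located UNSATISFIABLE at def-Y's flat pin already at `U = 1` (dag-n06-h `B9LettersHCOneObstruction`: a units defect, the kernel
carries `L^{+j(d+1)}`).  Track A's repair of record (R1-cls) re-classes the coarse middle class through ONE free positive weight per member (`Letters313Z`, `wZ = n⁻¹` at the knit); ★w1 g2
typed its T³ name `LettersRowZT3` (✓ p598201); n06-l's `thm313Printed_of_stepRelZ` is the matching leaf (the `_coGlob` leaf with `Letters313Z ∕ Letters313DZ` and the (3.42) co-readings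
RELATIVE to a site relation `Rel` — the «same carrier block» reading that meets the orphan-block ∕ class-vs-fibre issues at the record).  THIS FILE reads it at the T³ index:
§1 ★★ `t313_of_pins_T3_relZ` — `geo := geo9K`, `bg := bgT3`, `R₀ ≡ 1`, `Rel := B9CoRealizesRelAtLetters.RelB` (`c ∼ c′ :↔ β c = β c′`) with its SATURATION rows (`maj342_relB_left ∕ right`) and
MULTIPLICITY `m := 2·(2+1) = 6` (`B9CarrierBlockMultiplicity.card_sameCarrier_le_kIdx`) DISCHARGED, geometry rows discharged as in `t313_of_pins_T3_coGlob`; displayed: `hcoR ∕ hco1R`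
(`CoRealizesRel … (RelB i) …`), `hcoG`, `hmodel`, `hleft`, `wZ ∕ hwZ`, **`hletters := LettersRowZT3 𝔬 (fun _ ↦ 1) H₀ wZ hwZ c35 a₁ M₁ B₃ δ₃`**, `hlettersD` (`Letters313DZ`), shrunk `hres`, pins.
§2 ★★★ `normG_row_of_N06d3ObligationsZ` — §1 ∘ `Prop7SectET3NormG.normG_row_of_t313_classTransfer` (band `b₀ = b₁ = 1`): the displayed `norm_G` row of `Cmin_of_P6T3_chart_growth_pd` from the
Z-species obligations + (BG-336) + the two (115)-pins — the `norm_G` edge WITHOUT the flat-class letters (its `G₀`-side Z letters are inhabited at `U ≡ 1`: `lettersHZ_G0_one_T3` of the census).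
HONEST SCOPE: by-name ports (d := 2); N06(d = 3) NOT discharged; nothing here claims EX, the crux, V3∕R3, d = 4 or the mass gap; rung R3, not Clay.

References: T. Bałaban, CMP **99** (1985) 389–434 [Balaban1985BackgroundPropagators] (Thm 3.13 p.426, (3.126) p.420, (3.132) p.422, (3.147)–(3.153) pp.425–426, (3.42)–(3.47) pp.397–398, p.398
(remark after (3.47))); CMP **96** (1984) 223–250 [Balaban1984PropagatorsII] ((2.3) p.224, (2.45) p.231, Lemma 2.1 (2.60)–(2.61) p.234); CMP **102** (1985) 277–309 [Balaban1985Variational]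
((117) p.295); CMP **99** (1985) 75–102 [Balaban1985RegularSpaces] ((1.33) p.82).
-/

set_option autoImplicit false

noncomputable section

open scoped Matrix.Norms.L2Operator

namespace Summit.QuantumFields.YangMills.Theorems.Prop7SectET3N06LeavesRelZ

open Literature.MathematicalPhysics.QuantumFieldTheory.Balaban1983to89
open Literature.MathematicalPhysics.QuantumFieldTheory.Balaban1983to89.T3ContinuumYM3Torus
open Literature.MathematicalPhysics.QuantumFieldTheory.Balaban1983to89.T3PrintedRegularMinimiser (RegPr)
open Literature.MathematicalPhysics.QuantumFieldTheory.Balaban1983to89.B6KLevelCensusIndexV1 (KIdx)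
open Literature.MathematicalPhysics.QuantumFieldTheory.Balaban1983to89.B6GlobalChartV1 (PV)
open Literature.MathematicalPhysics.QuantumFieldTheory.Balaban1983to89.B9GeoNormsKLevelV1 (geo9K)
open Literature.MathematicalPhysics.QuantumFieldTheory.Balaban1983to89.B9Thm34Ext (toB6)
open Literature.MathematicalPhysics.QuantumFieldTheory.Balaban1983to89.B11SectG (RowSum BlockNorm)
open Literature.MathematicalPhysics.QuantumFieldTheory.Balaban1983to89.B9FromB6 (L2Block)
open Literature.MathematicalPhysics.QuantumFieldTheory.Balaban1983to89.B9Thm312Whole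
  (Ops GeoOK Thm33G0 Step FormSmall Identities HasRWExpOfOps PosDefKOfOps)
open Literature.MathematicalPhysics.QuantumFieldTheory.Balaban1983to89.B9Thm312WholeLeft (LeftStep)
open Literature.MathematicalPhysics.QuantumFieldTheory.Balaban1983to89.B9Thm313WholeZ (Letters313Z)
open Literature.MathematicalPhysics.QuantumFieldTheory.Balaban1983to89.B9Thm313WholeLeftZ (Letters313DZ)
open Literature.MathematicalPhysics.QuantumFieldTheory.Balaban1983to89.B9Thm313WholeLeafRelZ (thm313Printed_of_stepRelZ)
open Literature.MathematicalPhysics.QuantumFieldTheory.Balaban1983to89.B9Ineq347CoReading (CoReadsGlob)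
open Literature.MathematicalPhysics.QuantumFieldTheory.Balaban1983to89.B9CoRealizesRel (CoRealizesRel)
open Literature.MathematicalPhysics.QuantumFieldTheory.Balaban1983to89.B9CoRealizesRelAtLetters (RelB maj342_relB_left maj342_relB_right)
open Literature.MathematicalPhysics.QuantumFieldTheory.Balaban1983to89.B9CarrierBlockMultiplicity (card_sameCarrier_le_kIdx)
open Literature.MathematicalPhysics.QuantumFieldTheory.Balaban1983to89.B9GeoLemma21KLevelV1 (rowSum261_geo9K geo9K_one_le_L geo9K_eta_pos)
open Literature.MathematicalPhysics.QuantumFieldTheory.Balaban1983to89.B9GeoNormsKLevelModelSignsV1 (modelSignsOn_geo9K)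
open Summit.QuantumFields.YangMills.Theorems.Prop7SectET3Members (hd3 memberIdx)
open Summit.QuantumFields.YangMills.Theorems.Prop7SectET3Geometry (geoOK_geo9K geo9K_L_le lemma21AboveG_geo9K)
open Summit.QuantumFields.YangMills.Theorems.Prop7SectET3BgClass (bgT3 cfgV1OfT3 ClassTransferT3)
open Summit.QuantumFields.YangMills.Theorems.Prop7SectET3Letters (LettersRowZT3)
open Summit.QuantumFields.YangMills.Theorems.Prop7SectET3NormG (normG_row_of_t313_classTransfer)

variable {ℓ : ℕ} {hL : Odd (ℓ + 1) ∧ 1 < ℓ + 1} {b₀ b₁ : ℝ}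

/-! ## §1 Theorem 3.13's leaf at the T³ index, Z-classed letters, carrier-relative co-readings (`RelB`, saturation and multiplicity discharged) -/

/-- **THE CLASS MULTIPLICITY OF `RelB` IN THE LEAF's SHAPE** (any `Fintype` ∕ decidability instances): a carrier block of a T³-index member belongs to at most `2·(2+1) = 6` index bonds
(`B9CarrierBlockMultiplicity.card_sameCarrier_le_kIdx`, re-read over the leaf's `Finset.univ` of `(geo9K i).Site` and an arbitrary `DecidableRel (RelB i)`).
[cite: Balaban1984PropagatorsII, (2.3) p.224, (2.45) p.231] -/
theorem card_filter_relB_le (i : KIdx 2 ℓ hd3 hL b₀ b₁) [hF : Fintype (geo9K i).Site] [DecidableRel (RelB i)] (y' : (geo9K i).Site) :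
    ((Finset.univ : Finset (geo9K i).Site).filter (fun y'' => RelB i y'' y')).card ≤ 2 * (2 + 1) := by
  have h := card_sameCarrier_le_kIdx i y'
  refine le_trans (le_of_eq ?_) h
  apply congrArg Finset.card
  ext c
  rw [Finset.mem_filter, Finset.mem_filter]
  exact ⟨fun hc => ⟨Finset.mem_univ _, hc.2⟩, fun hc => ⟨@Finset.mem_univ _ hF c, hc.2⟩⟩

/-- ★★ **THEOREM 3.13's LEAF AT THE T³ INDEX IN THE REPAIRED LETTER SPECIES** (n06-l's `thm313Printed_of_stepRelZ` at d + 1 = 3): at `I := KIdx 2 ℓ hd3 hL b₀ b₁`, `geo := geo9K`,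
`bg := bgT3`, `R₀ ≡ 1`, site relation `RelB i` («same carrier block»): the displayed CARRIER-RELATIVE co-readings `hcoR` ((3.42)₀,₂) ∕ `hco1R` ((3.42)₁), the (3.47) co-readings `hcoG`,
the model hypotheses `hmodel` (Thm 3.3 for `G₀` = XL, Steps, FormSmall, Identities), `hleft`, ONE positive weight per member `wZ` and **the Z-classed letters `hletters : LettersRowZT3 𝔬 1 H₀ wZ
hwZ c35 a₁ M₁ B₃ δ₃`** (★w1 g2's name, ✓ p598201) + `hlettersD` (`Letters313DZ`), the shrunk residual `hres` ((3.46), (3.43)–(3.45)) and the two pins give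
`B9.Thm313Printed c35 geo9K bgT3 GG HasRWExp PosDefK`.  DISCHARGED here: the geometry rows (★w3), the SATURATION of `maj342 (geo9K i)` under `RelB` (`maj342_relB_left ∕ right`) and
the CLASS MULTIPLICITY `m = 6` (`card_sameCarrier_le_kIdx`: a carrier block belongs to ≤ 2(d+1) index bonds). [cite: Balaban1985BackgroundPropagators, Thm 3.13 p.426, (3.132) p.422, (3.126) p.420, (3.42)-(3.47) pp.397-398; Balaban1984PropagatorsII, (2.3) p.224, (2.45) p.231, Lemma 2.1 (2.60)-(2.61) p.234] -/
theorem t313_of_pins_T3_relZ [∀ i : KIdx 2 ℓ hd3 hL b₀ b₁, Fintype (geo9K i).Site]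
    {X Y Z W : KIdx 2 ℓ hd3 hL b₀ b₁ → Type} [∀ i, Fintype (X i)] [∀ i, DecidableEq (X i)] [∀ i, Fintype (Y i)] [∀ i, Fintype (Z i)] [∀ i, Fintype (W i)]
    (𝔬 : ∀ i : KIdx 2 ℓ hd3 hL b₀ b₁, Ops (geo9K i) (bgT3 i) (X i) (Y i) (Z i) (W i)) (H₀ : KIdx 2 ℓ hd3 hL b₀ b₁ → Prop)
    (GG : ∀ i : KIdx 2 ℓ hd3 hL b₀ b₁, B9.KernelFamily (geo9K i) (bgT3 i))
    (bH : ∀ i : KIdx 2 ℓ hd3 hL b₀ b₁, BlockNorm (toB6 (geo9K i) 1 (H₀ i)) (W i → ℝ))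
    (HasRWExp : ∀ i : KIdx 2 ℓ hd3 hL b₀ b₁, B9.KernelFamily (geo9K i) (bgT3 i) → (bgT3 i).Cfg → ℝ → Prop)
    (PosDefK : ∀ i : KIdx 2 ℓ hd3 hL b₀ b₁, B9.KernelFamily (geo9K i) (bgT3 i) → (bgT3 i).Cfg → Prop)
    (ev : ∀ i : KIdx 2 ℓ hd3 hL b₀ b₁, (geo9K i).Loc → X i → ℝ) (evY : ∀ i : KIdx 2 ℓ hd3 hL b₀ b₁, (geo9K i).Loc → Y i → ℝ)
    (c35 θ₁ θD r₁ B₀ δ₀ δK σ ρ a₁ M₁ B₁ δ₁ B₃ δ₃ ρ' κ₀ : ℝ) (Bβ Bε : ℝ → ℝ) (Bεβ : ℝ → ℝ → ℝ)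
    (hθ₁ : 0 ≤ θ₁) (hθD : 0 ≤ θD) (hr₁ : 0 ≤ r₁) (hB₀ : 0 ≤ B₀) (hB₃ : 0 ≤ B₃) (hσ : 0 < σ) (hρ' : 0 < ρ') (hρ'ρ : ρ' + 3 * σ ≤ ρ) (hρS : ρ ≤ δ₀) (hρ₃ : ρ ≤ δ₃)
    (hρδ : ρ + σ ≤ δK) (ha₁ : 0 < a₁) (hM₁ : 0 < M₁) (hδ₁ : 0 < δ₁) (hBβ : ∀ β, 0 ≤ Bβ β) (hBε : ∀ ε, 0 ≤ Bε ε) (hBεβ : ∀ ε β, 0 ≤ Bεβ ε β)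
    (hκ : ∀ i : KIdx 2 ℓ hd3 hL b₀ b₁, (bH i).κ ≤ κ₀)
    (hcoR : ∀ (i : KIdx 2 ℓ hd3 hL b₀ b₁) (U : (bgT3 i).Cfg),
      CoRealizesRel (GG i) 0 U (RelB i) (𝔬 i).blk (𝔬 i).blk (ev i) ((𝔬 i).GG U) ∧
      CoRealizesRel (GG i) 2 U (RelB i) (𝔬 i).blk (𝔬 i).blkY (evY i) ((𝔬 i).GG U ∘ₗ (𝔬 i).Dstar U))
    (hco1R : ∀ (i : KIdx 2 ℓ hd3 hL b₀ b₁) (U : (bgT3 i).Cfg), CoRealizesRel (GG i) 1 U (RelB i) (𝔬 i).blkY (𝔬 i).blk (ev i) ((𝔬 i).D U ∘ₗ (𝔬 i).GG U))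
    (hcoG : ∀ (i : KIdx 2 ℓ hd3 hL b₀ b₁) (U : (bgT3 i).Cfg),
      CoReadsGlob (GG i) 0 U (𝔬 i).blk (𝔬 i).blk (ev i) ((𝔬 i).GG U) ∧
      CoReadsGlob (GG i) 1 U (𝔬 i).blkY (𝔬 i).blk (ev i) ((𝔬 i).D U ∘ₗ (𝔬 i).GG U) ∧
      CoReadsGlob (GG i) 2 U (𝔬 i).blk (𝔬 i).blkY (evY i) ((𝔬 i).GG U ∘ₗ (𝔬 i).Dstar U))
    (hmodel : ∀ i : KIdx 2 ℓ hd3 hL b₀ b₁, M₁ ≤ (geo9K i).M → ∀ α₀ : ℝ, 0 < α₀ → (geo9K i).M * α₀ ≤ a₁ →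
      ∀ U : (bgT3 i).Cfg, (bgT3 i).Reg335 c35 α₀ U → (bgT3 i).Reg336 c35 α₀ U →
        Thm33G0 (𝔬 i) 1 (H₀ i) B₀ δ₀ U ∧
        Step (𝔬 i) 1 (H₀ i) (geoOK_geo9K i).lenle 1 (θ₁ * ((geo9K i).M * α₀)) δK U ∧
        Step (𝔬 i) 1 (H₀ i) (geoOK_geo9K i).lenle 2 (θ₁ * ((geo9K i).M * α₀)) δK U ∧
        FormSmall (𝔬 i) (r₁ * ((geo9K i).M * α₀)) U ∧ Identities (𝔬 i) U)
    (hleft : ∀ i : KIdx 2 ℓ hd3 hL b₀ b₁, M₁ ≤ (geo9K i).M → ∀ α₀ : ℝ, 0 < α₀ → (geo9K i).M * α₀ ≤ a₁ →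
      ∀ U : (bgT3 i).Cfg, (bgT3 i).Reg335 c35 α₀ U → (bgT3 i).Reg336 c35 α₀ U →
        LeftStep (𝔬 i) 1 (H₀ i) (geoOK_geo9K i).lenle B₀ δ₀ (θD * ((geo9K i).M * α₀)) δK U)
    (wZ : ∀ i : KIdx 2 ℓ hd3 hL b₀ b₁, (geo9K i).Site → ℝ) (hwZ : ∀ i y, 0 < wZ i y)
    (hletters : LettersRowZT3 𝔬 (fun _ => 1) H₀ wZ hwZ c35 a₁ M₁ B₃ δ₃)
    (hlettersD : ∀ i : KIdx 2 ℓ hd3 hL b₀ b₁, M₁ ≤ (geo9K i).M → ∀ α₀ : ℝ, 0 < α₀ → (geo9K i).M * α₀ ≤ a₁ →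
      ∀ U : (bgT3 i).Cfg, (bgT3 i).Reg335 c35 α₀ U → (bgT3 i).Reg336 c35 α₀ U →
        Letters313DZ (𝔬 i) 1 (H₀ i) (geoOK_geo9K i) (wZ i) (hwZ i) B₃ δ₃ (bH i) U)
    (hres : ∀ i : KIdx 2 ℓ hd3 hL b₀ b₁, M₁ ≤ (geo9K i).M → ∀ α₀ : ℝ, 0 < α₀ → (geo9K i).M * α₀ ≤ a₁ →
      ∀ U : (bgT3 i).Cfg, (bgT3 i).Reg335 c35 α₀ U → (bgT3 i).Reg336 c35 α₀ U →
        L2Block (GG i) B₁ δ₁ U ∧ B9.Ineq343_345 (GG i) Bβ Bε Bεβ δ₁ U)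
    (hpinE : ∀ i : KIdx 2 ℓ hd3 hL b₀ b₁, HasRWExp i = HasRWExpOfOps (𝔬 i)) (hpinK : ∀ i : KIdx 2 ℓ hd3 hL b₀ b₁, PosDefK i = PosDefKOfOps (𝔬 i)) :
    B9.Thm313Printed c35 geo9K bgT3 GG HasRWExp PosDefK := by
  classical
  have hE : HasRWExp = fun i => HasRWExpOfOps (𝔬 i) := funext hpinE
  have hK : PosDefK = fun i => PosDefKOfOps (𝔬 i) := funext hpinK
  rw [hE, hK]
  obtain ⟨ML, c, hrow⟩ := rowSum261_geo9K (d := 2) (ℓ := ℓ) (hd := hd3) (hL := hL) (b₀ := b₀) (b₁ := b₁) σ hσ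
  have hL21 := lemma21AboveG_geo9K (d := 2) (ℓ := ℓ) (hd := hd3) (hL := hL) (b₀ := b₀) (b₁ := b₁) H₀ (α := 1 / 2) (by norm_num) (by norm_num)
  exact thm313Printed_of_stepRelZ 𝔬 (fun _ => 1) H₀ GG bH ev evY (fun i => RelB i) (2 * (2 + 1)) θ₁ θD r₁ B₀ δ₀ δK σ (max c 0) ρ a₁ M₁ ML B₁ δ₁ B₃ δ₃ ρ' (1 / 2)
    (((ℓ + 1 : ℕ) : ℝ)) κ₀ Bβ Bε Bεβ hθ₁ hθD hr₁ hB₀ hB₃ hσ.le hρ' hρ'ρ hρS hρ₃ hρδ (le_max_right _ _) ha₁ hM₁ hδ₁ hBβ hBε hBεβ (fun i => geoOK_geo9K i)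
    (fun i => modelSignsOn_geo9K i) (fun i => geo9K_one_le_L i) (fun i => geo9K_L_le i) (fun i => geo9K_eta_pos i) hκ (fun i hM y => (hrow i hM y).trans (le_max_left _ _))
    hL21 (fun i n B' δ' => ⟨fun a a' b h => maj342_relB_left i n B' δ' a a' b h, fun a b b' h => maj342_relB_right i n B' δ' a b b' h⟩) (fun i y' => card_filter_relB_le i y')
    hcoR hco1R hcoG hmodel hleft wZ hwZ (fun i hM α₀ hα₀ hMa U hU hU' => hletters i hM α₀ hα₀ hMa U hU hU') hlettersD hres

/-! ## §2 The displayed `norm_G` row of C-min from the Z-species obligations — no flat-class letter displayed -/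

/-- ★★★ **THE `norm_G` ROW OF C-min FROM THE Z-SPECIES N06(d = 3) OBLIGATIONS** (§1 ∘ `Prop7SectET3NormG.normG_row_of_t313_classTransfer`, band `b₀ = b₁ = 1` of `memberIdx`): the
displayed obligations of §1 (carrier-relative co-readings, `hcoG`, `hmodel` with the XL item `Thm33G0`, `hleft`, **`hletters = LettersRowZT3 …`**, `hlettersD`, shrunk `hres`), ★w1 g2's
class-transfer row `ClassTransferT3 ℓ hL c35` (BG-336) and an operator family `Gop i U : Xo i U → Yo i U` read by `GG`'s (3.47) entries (`hw`, `hglob`) give `M₄, a₀, B₀′ > 0` with: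
for every member `memberIdx ℓ hL hℓ m hm n K a' R …` whose `M = L·L^{a'}` clears `M₄`, every `e ≤ a₀∕(L·L^{a'})`, every SU(2) field `U₀ ∈ RegPr ⟨ℓ+1, hL, m, hm⟩ n K e` and every `f`,
`‖Gop (memberIdx …) (cfgV1OfT3 U₀) f‖ ≤ B₀′‖f‖` — the displayed `norm_G` row of `Cmin_of_P6T3_chart_growth_pd` in its shape, its letter content now in the repaired (Z) species whose
`G₀`-side rows are inhabited at `U ≡ 1` (`Prop7SectET3LettersAtOne.lettersHZ_G0_one_T3`).
[cite: Balaban1985Variational, (117) p.295; Balaban1985BackgroundPropagators, Thm 3.13 p.426, (3.47) p.398, (3.132) p.422; Balaban1985RegularSpaces, (1.33) p.82] -/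
theorem normG_row_of_N06d3ObligationsZ [∀ i : KIdx 2 ℓ hd3 hL 1 1, Fintype (geo9K i).Site]
    {X Y Z W : KIdx 2 ℓ hd3 hL 1 1 → Type} [∀ i, Fintype (X i)] [∀ i, DecidableEq (X i)] [∀ i, Fintype (Y i)] [∀ i, Fintype (Z i)] [∀ i, Fintype (W i)]
    (𝔬 : ∀ i : KIdx 2 ℓ hd3 hL 1 1, Ops (geo9K i) (bgT3 i) (X i) (Y i) (Z i) (W i)) (H₀ : KIdx 2 ℓ hd3 hL 1 1 → Prop)
    (GG : ∀ i : KIdx 2 ℓ hd3 hL 1 1, B9.KernelFamily (geo9K i) (bgT3 i))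
    (bH : ∀ i : KIdx 2 ℓ hd3 hL 1 1, BlockNorm (toB6 (geo9K i) 1 (H₀ i)) (W i → ℝ))
    (ev : ∀ i : KIdx 2 ℓ hd3 hL 1 1, (geo9K i).Loc → X i → ℝ) (evY : ∀ i : KIdx 2 ℓ hd3 hL 1 1, (geo9K i).Loc → Y i → ℝ)
    (c35 θ₁ θD r₁ B₀ δ₀ δK σ ρ a₁ M₁ B₁ δ₁ B₃ δ₃ ρ' κ₀ : ℝ) (Bβ Bε : ℝ → ℝ) (Bεβ : ℝ → ℝ → ℝ)
    (hθ₁ : 0 ≤ θ₁) (hθD : 0 ≤ θD) (hr₁ : 0 ≤ r₁) (hB₀ : 0 ≤ B₀) (hB₃ : 0 ≤ B₃) (hσ : 0 < σ) (hρ' : 0 < ρ') (hρ'ρ : ρ' + 3 * σ ≤ ρ) (hρS : ρ ≤ δ₀) (hρ₃ : ρ ≤ δ₃)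
    (hρδ : ρ + σ ≤ δK) (ha₁ : 0 < a₁) (hM₁ : 0 < M₁) (hδ₁ : 0 < δ₁) (hBβ : ∀ β, 0 ≤ Bβ β) (hBε : ∀ ε, 0 ≤ Bε ε) (hBεβ : ∀ ε β, 0 ≤ Bεβ ε β)
    (hκ : ∀ i : KIdx 2 ℓ hd3 hL 1 1, (bH i).κ ≤ κ₀)
    (hcoR : ∀ (i : KIdx 2 ℓ hd3 hL 1 1) (U : (bgT3 i).Cfg),
      CoRealizesRel (GG i) 0 U (RelB i) (𝔬 i).blk (𝔬 i).blk (ev i) ((𝔬 i).GG U) ∧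
      CoRealizesRel (GG i) 2 U (RelB i) (𝔬 i).blk (𝔬 i).blkY (evY i) ((𝔬 i).GG U ∘ₗ (𝔬 i).Dstar U))
    (hco1R : ∀ (i : KIdx 2 ℓ hd3 hL 1 1) (U : (bgT3 i).Cfg), CoRealizesRel (GG i) 1 U (RelB i) (𝔬 i).blkY (𝔬 i).blk (ev i) ((𝔬 i).D U ∘ₗ (𝔬 i).GG U))
    (hcoG : ∀ (i : KIdx 2 ℓ hd3 hL 1 1) (U : (bgT3 i).Cfg),
      CoReadsGlob (GG i) 0 U (𝔬 i).blk (𝔬 i).blk (ev i) ((𝔬 i).GG U) ∧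
      CoReadsGlob (GG i) 1 U (𝔬 i).blkY (𝔬 i).blk (ev i) ((𝔬 i).D U ∘ₗ (𝔬 i).GG U) ∧
      CoReadsGlob (GG i) 2 U (𝔬 i).blk (𝔬 i).blkY (evY i) ((𝔬 i).GG U ∘ₗ (𝔬 i).Dstar U))
    (hmodel : ∀ i : KIdx 2 ℓ hd3 hL 1 1, M₁ ≤ (geo9K i).M → ∀ α₀ : ℝ, 0 < α₀ → (geo9K i).M * α₀ ≤ a₁ →
      ∀ U : (bgT3 i).Cfg, (bgT3 i).Reg335 c35 α₀ U → (bgT3 i).Reg336 c35 α₀ U →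
        Thm33G0 (𝔬 i) 1 (H₀ i) B₀ δ₀ U ∧
        Step (𝔬 i) 1 (H₀ i) (geoOK_geo9K i).lenle 1 (θ₁ * ((geo9K i).M * α₀)) δK U ∧
        Step (𝔬 i) 1 (H₀ i) (geoOK_geo9K i).lenle 2 (θ₁ * ((geo9K i).M * α₀)) δK U ∧
        FormSmall (𝔬 i) (r₁ * ((geo9K i).M * α₀)) U ∧ Identities (𝔬 i) U)
    (hleft : ∀ i : KIdx 2 ℓ hd3 hL 1 1, M₁ ≤ (geo9K i).M → ∀ α₀ : ℝ, 0 < α₀ → (geo9K i).M * α₀ ≤ a₁ →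
      ∀ U : (bgT3 i).Cfg, (bgT3 i).Reg335 c35 α₀ U → (bgT3 i).Reg336 c35 α₀ U →
        LeftStep (𝔬 i) 1 (H₀ i) (geoOK_geo9K i).lenle B₀ δ₀ (θD * ((geo9K i).M * α₀)) δK U)
    (wZ : ∀ i : KIdx 2 ℓ hd3 hL 1 1, (geo9K i).Site → ℝ) (hwZ : ∀ i y, 0 < wZ i y)
    (hletters : LettersRowZT3 𝔬 (fun _ => 1) H₀ wZ hwZ c35 a₁ M₁ B₃ δ₃)
    (hlettersD : ∀ i : KIdx 2 ℓ hd3 hL 1 1, M₁ ≤ (geo9K i).M → ∀ α₀ : ℝ, 0 < α₀ → (geo9K i).M * α₀ ≤ a₁ →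
      ∀ U : (bgT3 i).Cfg, (bgT3 i).Reg335 c35 α₀ U → (bgT3 i).Reg336 c35 α₀ U →
        Letters313DZ (𝔬 i) 1 (H₀ i) (geoOK_geo9K i) (wZ i) (hwZ i) B₃ δ₃ (bH i) U)
    (hres : ∀ i : KIdx 2 ℓ hd3 hL 1 1, M₁ ≤ (geo9K i).M → ∀ α₀ : ℝ, 0 < α₀ → (geo9K i).M * α₀ ≤ a₁ →
      ∀ U : (bgT3 i).Cfg, (bgT3 i).Reg335 c35 α₀ U → (bgT3 i).Reg336 c35 α₀ U →
        L2Block (GG i) B₁ δ₁ U ∧ B9.Ineq343_345 (GG i) Bβ Bε Bεβ δ₁ U)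
    -- the class-transfer row (BG-336) and the operator family read by `GG`'s (3.47) entries at `γ = −3`
    (hCT : ClassTransferT3 ℓ hL c35)
    {Xo Yo : ∀ i : KIdx 2 ℓ hd3 hL 1 1, (bgT3 i).Cfg → Type} [∀ i U, SeminormedAddCommGroup (Xo i U)] [∀ i U, SeminormedAddCommGroup (Yo i U)]
    (Gop : ∀ (i : KIdx 2 ℓ hd3 hL 1 1) (U : (bgT3 i).Cfg), Xo i U → Yo i U) (ιo : ∀ (i : KIdx 2 ℓ hd3 hL 1 1) (U : (bgT3 i).Cfg), Xo i U → (geo9K i).Loc)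
    (hw : ∀ (i : KIdx 2 ℓ hd3 hL 1 1) (U : (bgT3 i).Cfg) (f : Xo i U), (geo9K i).wNorm (-3) (ιo i U f) ≤ ‖f‖)
    (hglob : ∀ (i : KIdx 2 ℓ hd3 hL 1 1) (U : (bgT3 i).Cfg) (f : Xo i U), ‖Gop i U f‖ ≤ max ((GG i).glob 0 U (ιo i U f) (-3)) ((GG i).glob 1 U (ιo i U f) (-3))) :
    ∃ M₄ a₀ B₀' : ℝ, 0 < M₄ ∧ 0 < a₀ ∧ 0 < B₀' ∧
      ∀ (hℓ : 4 ≤ ℓ) (m : ℕ) (hm : 1 ≤ m) (n K a' R : ℕ) (hk1 : 1 ≤ K - n) (hsize : a' + 3 ≤ m + n) (hM8 : 8 ≤ (ℓ + 1) ^ a') (hR2 : 2 * (ℓ + 1) ^ 2 ≤ R),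
        M₄ ≤ ((ℓ + 1 : ℕ) : ℝ) * (((ℓ + 1) ^ a' : ℕ) : ℝ) →
        ∀ (e : ℝ) (U₀ : GaugeField (PV 2 ℓ m K hd3 hL) 0 (Matrix.specialUnitaryGroup (Fin 2) ℂ)),
          RegPr (⟨ℓ + 1, hL, m, hm⟩ : T3Family) n K e U₀ → e ≤ a₀ / (((ℓ + 1 : ℕ) : ℝ) * (((ℓ + 1) ^ a' : ℕ) : ℝ)) →
            ∀ f : Xo (memberIdx ℓ hL hℓ m hm n K a' R hk1 hsize hM8 hR2) (cfgV1OfT3 U₀),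
              ‖Gop (memberIdx ℓ hL hℓ m hm n K a' R hk1 hsize hM8 hR2) (cfgV1OfT3 U₀) f‖ ≤ B₀' * ‖f‖ :=
  normG_row_of_t313_classTransfer
    (t313_of_pins_T3_relZ 𝔬 H₀ GG bH (fun i => HasRWExpOfOps (𝔬 i)) (fun i => PosDefKOfOps (𝔬 i)) ev evY c35 θ₁ θD r₁ B₀ δ₀ δK σ ρ a₁ M₁ B₁ δ₁ B₃ δ₃ ρ' κ₀ Bβ Bε Bεβ
      hθ₁ hθD hr₁ hB₀ hB₃ hσ hρ' hρ'ρ hρS hρ₃ hρδ ha₁ hM₁ hδ₁ hBβ hBε hBεβ hκ hcoR hco1R hcoG hmodel hleft wZ hwZ hletters hlettersD hres (fun _ => rfl) (fun _ => rfl))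
    hCT Gop ιo hw hglob

end Summit.QuantumFields.YangMills.Theorems.Prop7SectET3N06LeavesRelZ

end
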